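import Summits.CriticalPhenomena.PercolationContinuityZ3.Theorems.FK.NewmanCLTDominatedBlocks
import Summits.CriticalPhenomena.PercolationContinuityZ3.Theorems.FK.NewmanCLT
import HarnessLib

/-!
# NEWMAN'S CENTRAL LIMIT THEOREM FOR DOMINATED (NON-MONOTONE) FIELDS: if `X` is dominated by an increasing field `X̃`
# under a positively associated measure and both covariance kernels are summable, `(S_n − E S_n)/√|Λ_n| ⇒ N(0, Σ_z γ(z))`

Claimed R42 (8)(c) in the cell INBOX at 2026-08-28T14:25:01Z by fkp-10a gen 354 (NEW CLAIM #3 of the gen), addressed to coordinator fk-4 g274 (seated 13:10Z 2026-08-28 by l.8389; R151 l.8390, R152 l.8413); lineage row FO-10a-g354g (self-suggested), package g354-cltgeneral, label GD-C.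
Helper file of the `fk-continuity` build cell (bschramm lane; `--supports stmt-CriticalPhenomena-4575`); builds on
p205010 (kernel theorem, internal audit signed; external expert review pending). No definitions, no named facts, no
sorries; standard axioms. UNCONDITIONAL. GENERIC (`d ≥ 1`).

This is Newman's Thm. 2 freed from monotonicity (Newman 1980, remark after (12); Newman 1983): `μ` positively
associated; `X : Site d → Ω → ℝ` measurable, `|X_z| ≤ M`, `Cov(X_x, X_y) = γ(y−x)` with `γ` SUMMABLE (of any sign);
`X` dominated by a measurable bounded field `X̃` (`|X_z ω' − X_z ω| ≤ X̃_z ω' − X̃_z ω` for `ω ≤ ω'`) whose kernel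
`γ̃` (`Cov(X̃_x, X̃_y) = γ̃(y−x)`) is summable. Then with `S_n = Σ_{z∈Λ_n} X_z`, `σ² = Σ_z γ(z) ≥ 0`:

* `tendsto_sum_sum_box_div_card_of_summable` — `|Λ_L|⁻¹ Σ_{x,y∈Λ_L} γ(y−x) → Σ_z γ(z)` for a summable kernel of
  any sign (positive and negative parts, `tendsto_sum_sum_box_div_card`);
* `abs_sum_covSum_blocks_sub_le` — the within-block variance of `Λ_n` differs from the full-block part
  `|Λ_m|·V_k` by at most `Γ·(|Λ_n| − |Λ_m||Λ_k|)`, `Γ = Σ_z |γ(z)|`;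
* `norm_charFun_boxSum_sub_le_of_dominated` — the quantitative finite-`n` estimate;
* `tendsto_charFun_boxSum_of_dominated`, `tendstoInDistribution_boxSum_of_dominated` — the CLT.

## References

* C. M. Newman, *Normal fluctuations and the FKG inequalities*, Comm. Math. Phys. 74 (1980) 119–128, Thm. 2 and the
  remark after (12); C. M. Newman, *A general central limit theorem for FKG systems*, Comm. Math. Phys. 91 (1983)
  75–80. [Newman1980]
* G. Grimmett, *The Random-Cluster Model*, Springer 2006, Thm. (4.17)(b), (4.19)(b). [Grimmett2006]
-/

noncomputable section

namespace Summit.CriticalPhenomena.PercolationContinuityZ3.Theorems.FK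

namespace NewmanCLT

open MeasureTheory ProbabilityTheory Complex Finset Filter Topology
open Literature.Probability.Percolation Literature.Probability.LatticeModels

variable {d : ℕ}

/-! ### Signed kernels: per-site double sums -/

/-- **Per-site double sums of a summable kernel of any sign**: `|Λ_L|⁻¹ Σ_{x,y∈Λ_L} γ(y−x) → Σ_z γ(z)`
(split `γ = γ⁺ − γ⁻` and use `tendsto_sum_sum_box_div_card`). [cite: Newman1980, Thm. 2 (D)] -/
theorem tendsto_sum_sum_box_div_card_of_summable (γ : Site d → ℝ) (hγ : Summable γ) :
    Tendsto (fun L : ℕ => (∑ x ∈ box d L, ∑ y ∈ box d L, γ (y - x)) / #(box d L)) atTop (𝓝 (∑' z, γ z)) := by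
  have hγa : Summable fun z => |γ z| := hγ.abs
  have hp : Summable fun z => max (γ z) 0 :=
    hγa.of_nonneg_of_le (fun z => le_max_right _ _) fun z => max_le (le_abs_self _) (abs_nonneg _)
  have hn : Summable fun z => max (-γ z) 0 :=
    hγa.of_nonneg_of_le (fun z => le_max_right _ _) fun z => max_le (neg_le_abs _) (abs_nonneg _)
  have h1 := tendsto_sum_sum_box_div_card (fun z => max (γ z) 0) (fun z => le_max_right _ _) hp
  have h2 := tendsto_sum_sum_box_div_card (fun z => max (-γ z) 0) (fun z => le_max_right _ _) hn
  have h := h1.sub h2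
  rw [← hp.tsum_sub hn] at h
  simp only [max_zero_sub_max_neg_zero_eq_self] at h
  refine h.congr fun L => ?_
  rw [← sub_div, ← Finset.sum_sub_distrib]
  congr 1
  refine Finset.sum_congr rfl fun x _ => ?_
  rw [← Finset.sum_sub_distrib]
  exact Finset.sum_congr rfl fun y _ => max_zero_sub_max_neg_zero_eq_self _

/-! ### The within-block variance against the full blocks -/

/-- **Full blocks carry the within-block variance up to the boundary**: with the block map `β_k`,
`m = ⌊(n−k)/(2k+1)⌋` and `Γ = Σ_z |γ(z)|`,
`|W − |Λ_m|·V_k| ≤ Γ·(|Λ_n| − |Λ_m||Λ_k|)` and `|Λ_m||Λ_k| ≤ |Λ_n|`, where `W = Σ_{u∈β(Λ_n)} Σ_{x,y∈Λ_n∩β⁻¹u} γ(y−x)`,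
`V_k = Σ_{x,y∈Λ_k} γ(y−x)`. [cite: Newman1980, proof of Thm. 2] -/
theorem abs_sum_covSum_blocks_sub_le [DecidableEq (Site d)] (γ : Site d → ℝ) (hγ : Summable γ) {k n : ℕ}
    (hkn : k ≤ n) {β : Site d → Site d} (hβ : ∀ z i, β z i = (z i + k) / (2 * k + 1)) :
    (#(box d ((n - k) / (2 * k + 1))) : ℝ) * #(box d k) ≤ #(box d n) ∧
    |(∑ u ∈ (box d n).image β, ∑ x ∈ (box d n).filter (fun z => β z = u),
        ∑ y ∈ (box d n).filter (fun z => β z = u), γ (y - x)) -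
      #(box d ((n - k) / (2 * k + 1))) * ∑ x ∈ box d k, ∑ y ∈ box d k, γ (y - x)| ≤
      (∑' z, |γ z|) * (#(box d n) - #(box d ((n - k) / (2 * k + 1))) * #(box d k)) := by
  have hkm := blockCount_spec hkn
  set m := (n - k) / (2 * k + 1) with hm
  set U := (box d n).image β with hU
  set F : Site d → Finset (Site d) := fun u => (box d n).filter (fun z => β z = u) with hF
  have hsub : box d m ⊆ U := box_subset_image_blockLabel hβ hkm
  -- fibre cards
  have hcardF : ∀ u ∈ box d m, #(F u) = #(box d k) := fun u hu => by
    simp only [hF]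
    rw [filter_blockLabel_eq_image hβ hkm hu, Finset.card_image_of_injective]
    intro w w' h
    funext i; have := congr_fun h i; simpa using this
  have hN : (#(box d n) : ℝ) = ∑ u ∈ U, (#(F u) : ℝ) := by
    rw [hU, Finset.card_eq_sum_card_image β (box d n)]; push_cast; rfl
  have hsplitN : ∑ u ∈ U, (#(F u) : ℝ) = #(box d m) * #(box d k) + ∑ u ∈ U \ box d m, (#(F u) : ℝ) := by
    rw [← Finset.sum_sdiff hsub, add_comm]
    congr 1
    rw [Finset.sum_congr rfl fun u hu => by rw [hcardF u hu], Finset.sum_const, nsmul_eq_mul]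
  have hrest0 : 0 ≤ ∑ u ∈ U \ box d m, (#(F u) : ℝ) := Finset.sum_nonneg fun u _ => Nat.cast_nonneg _
  refine ⟨by rw [hN, hsplitN]; linarith, ?_⟩
  -- split `W`
  have hW : ∑ u ∈ U, ∑ x ∈ F u, ∑ y ∈ F u, γ (y - x) =
      #(box d m) * ∑ x ∈ box d k, ∑ y ∈ box d k, γ (y - x) + ∑ u ∈ U \ box d m, ∑ x ∈ F u, ∑ y ∈ F u, γ (y - x) := by
    rw [← Finset.sum_sdiff hsub, add_comm]
    congr 1
    rw [Finset.sum_congr rfl fun u hu => by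
      rw [show ∑ x ∈ F u, ∑ y ∈ F u, γ (y - x) = ∑ x ∈ box d k, ∑ y ∈ box d k, γ (y - x) by
        simp only [hF]; rw [filter_blockLabel_eq_image hβ hkm hu,
          sum_sum_image_add_eq γ (fun i => (2 * k + 1 : ℤ) * u i) k]],
      Finset.sum_const, nsmul_eq_mul]
  rw [hW, add_sub_cancel_left, hN, hsplitN, add_sub_cancel_left, Finset.mul_sum]
  refine (Finset.abs_sum_le_sum_abs _ _).trans (Finset.sum_le_sum fun u _ => ?_)
  rw [mul_comm]
  exact abs_sum_sum_kernel_le hγ (F u) (F u)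

/-! ### The quantitative estimate and the CLT -/

variable {Ω : Type*} [MeasurableSpace Ω] [Preorder Ω] {μ : Measure Ω} [IsProbabilityMeasure μ]
  {X Xd : Site d → Ω → ℝ} {M Md : ℝ} {γ γd : Site d → ℝ}

/-- **Newman's CLT for dominated fields, quantitative finite-`n` form**: for `k ≤ n`, `s = t/√|Λ_n|`, `s²K² ≤ 2`
(`K = 2M|Λ_k|`): `‖E e^{is(S_n − E S_n)} − e^{−σ²t²/2}‖ ≤ 2t²Δ̃ + t²(|s|K³ + s²K⁴) + (t²/2)(|a(k) − σ²| + 2Γ(1 − r))`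
with `Δ̃ = ã(n) − r ã(k)` (dominating kernel), `r = |Λ_m||Λ_k|/|Λ_n|`, `Γ = Σ|γ|`, `σ² = Σγ`.
[cite: Newman1980, Thm. 1 (11), remark after (12), proof of Thm. 2] -/
theorem norm_charFun_boxSum_sub_le_of_dominated (hμ : IsPositivelyAssociated μ) (hXm : ∀ z, Measurable (X z))
    (hM : 0 ≤ M) (hXb : ∀ z ω, |X z ω| ≤ M) (hcov : ∀ x y, cov[X x, X y; μ] = γ (y - x)) (hγ : Summable γ)
    (hXdm : ∀ z, Measurable (Xd z)) (hXdb : ∀ z ω, |Xd z ω| ≤ Md) (hcovd : ∀ x y, cov[Xd x, Xd y; μ] = γd (y - x))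
    (hdom : ∀ z, ∀ ⦃ω ω'⦄, ω ≤ ω' → |X z ω' - X z ω| ≤ Xd z ω' - Xd z ω)
    {k n : ℕ} (hkn : k ≤ n) (t : ℝ) (hs : (t / Real.sqrt #(box d n)) ^ 2 * (2 * M * #(box d k)) ^ 2 ≤ 2) :
    ‖∫ ω, cexp ((((t / Real.sqrt #(box d n)) * (∑ z ∈ box d n, X z ω - ∫ ω', ∑ z ∈ box d n, X z ω' ∂μ) : ℝ) : ℂ) * I) ∂μ -
        ((Real.exp (-((∑' z, γ z) * t ^ 2 / 2)) : ℝ) : ℂ)‖ ≤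
      2 * t ^ 2 * ((∑ x ∈ box d n, ∑ y ∈ box d n, γd (y - x)) / #(box d n) -
          #(box d ((n - k) / (2 * k + 1))) * (∑ x ∈ box d k, ∑ y ∈ box d k, γd (y - x)) / #(box d n)) +
        t ^ 2 * (|t / Real.sqrt #(box d n)| * (2 * M * #(box d k)) ^ 3 +
          (t / Real.sqrt #(box d n)) ^ 2 * (2 * M * #(box d k)) ^ 4) +
        t ^ 2 / 2 * (|(∑ x ∈ box d k, ∑ y ∈ box d k, γ (y - x)) / #(box d k) - ∑' z, γ z| +
          2 * (∑' z, |γ z|) * (1 - #(box d ((n - k) / (2 * k + 1))) * #(box d k) / #(box d n))) := by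
  classical
  set N : ℝ := (#(box d n) : ℝ) with hN
  set s : ℝ := t / Real.sqrt N with hsdef
  set K : ℝ := 2 * M * #(box d k) with hK
  set β : Site d → Site d := fun z i => (z i + k) / (2 * k + 1) with hβdef
  have hβ : ∀ z i, β z i = (z i + k) / (2 * k + 1) := fun z i => rfl
  set Vk : ℝ := ∑ x ∈ box d k, ∑ y ∈ box d k, γ (y - x) with hVk
  set W : ℝ := ∑ u ∈ (box d n).image β, ∑ x ∈ (box d n).filter (fun z => β z = u),
    ∑ y ∈ (box d n).filter (fun z => β z = u), γ (y - x) with hW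
  set Vd : ℝ := ∑ x ∈ box d n, ∑ y ∈ box d n, γd (y - x) with hVd
  set Vdk : ℝ := ∑ x ∈ box d k, ∑ y ∈ box d k, γd (y - x) with hVdk
  set Wd : ℝ := ∑ u ∈ (box d n).image β, ∑ x ∈ (box d n).filter (fun z => β z = u),
    ∑ y ∈ (box d n).filter (fun z => β z = u), γd (y - x) with hWd
  set σ2 : ℝ := ∑' z, γ z with hσ2
  set Γ : ℝ := ∑' z, |γ z| with hΓ
  set Nm : ℝ := (#(box d ((n - k) / (2 * k + 1))) : ℝ) with hNm
  set Nk : ℝ := (#(box d k) : ℝ) with hNk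
  have hNpos : 0 < N := card_box_pos d n
  have hNkpos : 0 < Nk := card_box_pos d k
  have hsqN : Real.sqrt N ^ 2 = N := Real.sq_sqrt hNpos.le
  have hs2 : s ^ 2 = t ^ 2 / N := by rw [hsdef, div_pow, hsqN]
  have hXdmono : ∀ z, Monotone (Xd z) := monotone_of_dominated_field hdom
  -- the block estimate
  have hB := norm_integral_cexp_blockSum_sub_exp_le_of_dominated hμ hXm hM hXb hcov hXdm hXdb hcovd hdom (box d n) β
    (κ := #(box d k)) (card_filter_blockLabel_le hβ (box d n)) (s := s) hs
  -- dominating kernel: `|Λ_m| Ṽ_k ≤ W̃`, `#blocks ≤ N`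
  have hWdlow : Nm * Vdk ≤ Wd := card_mul_sum_le_sum_covSum_blocks hμ hXdm hXdmono hXdb hcovd hkn hβ
  have hU : (#((box d n).image β) : ℝ) ≤ N := by rw [hN]; exact_mod_cast card_image_le
  -- `W ≥ 0`, `σ² ≥ 0`, `|W/N − σ²| ≤ |a(k) − σ²| + 2Γ(1 − r)`
  have hW0 : 0 ≤ W := Finset.sum_nonneg fun u _ => sum_sum_kernel_self_nonneg hXm hXb hcov _
  have ha_nn : ∀ L : ℕ, 0 ≤ (∑ x ∈ box d L, ∑ y ∈ box d L, γ (y - x)) / #(box d L) := fun L =>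
    div_nonneg (sum_sum_kernel_self_nonneg hXm hXb hcov _) (Nat.cast_nonneg _)
  have hσ0 : 0 ≤ σ2 :=
    ge_of_tendsto' (tendsto_sum_sum_box_div_card_of_summable γ hγ) ha_nn
  have hσΓ : |σ2| ≤ Γ := by
    rw [hσ2, hΓ]
    exact (norm_tsum_le_tsum_norm hγ.norm).trans_eq (by simp [Real.norm_eq_abs])
  obtain ⟨hrle, hWest⟩ := abs_sum_covSum_blocks_sub_le γ hγ hkn hβ
  have hrle' : Nm * Nk ≤ N := hrle
  have hWest' : |W - Nm * Vk| ≤ Γ * (N - Nm * Nk) := hWest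
  have hr0 : 0 ≤ Nm * Nk / N := div_nonneg (mul_nonneg (Nat.cast_nonneg _) (Nat.cast_nonneg _)) hNpos.le
  have hr1 : Nm * Nk / N ≤ 1 := (div_le_one hNpos).2 hrle'
  have hWN : |W / N - σ2| ≤ |Vk / Nk - σ2| + 2 * Γ * (1 - Nm * Nk / N) := by
    have hdecomp : W / N - σ2 = (W - Nm * Vk) / N + ((Nm * Nk / N) * (Vk / Nk - σ2) - (1 - Nm * Nk / N) * σ2) := by
      field_simp
      ring
    have hA : |(W - Nm * Vk) / N| ≤ Γ * (1 - Nm * Nk / N) := by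
      rw [abs_div, abs_of_pos hNpos, div_le_iff₀ hNpos]
      refine hWest'.trans (le_of_eq ?_)
      field_simp
    have hB : |(Nm * Nk / N) * (Vk / Nk - σ2) - (1 - Nm * Nk / N) * σ2| ≤ |Vk / Nk - σ2| + Γ * (1 - Nm * Nk / N) := by
      refine (abs_sub _ _).trans ?_
      rw [abs_mul, abs_mul, abs_of_nonneg hr0, abs_of_nonneg (sub_nonneg.2 hr1)]
      have i1 : Nm * Nk / N * |Vk / Nk - σ2| ≤ |Vk / Nk - σ2| := by
        have := mul_le_mul_of_nonneg_right hr1 (abs_nonneg (Vk / Nk - σ2)); linarith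
      have i2 : (1 - Nm * Nk / N) * |σ2| ≤ (1 - Nm * Nk / N) * Γ := mul_le_mul_of_nonneg_left hσΓ (by linarith)
      linarith
    rw [hdecomp]
    refine (abs_add_le _ _).trans ?_
    linarith
  -- Gaussian comparison
  have hG : ‖((Real.exp (-(s ^ 2 * W / 2)) : ℝ) : ℂ) - ((Real.exp (-(σ2 * t ^ 2 / 2)) : ℝ) : ℂ)‖ ≤
      t ^ 2 / 2 * (|Vk / Nk - σ2| + 2 * Γ * (1 - Nm * Nk / N)) := by
    rw [← Complex.ofReal_sub, Complex.norm_real, Real.norm_eq_abs]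
    refine (Literature.NumberTheory.LFunctions.abs_exp_neg_sub_exp_neg_le (div_nonneg (mul_nonneg (sq_nonneg _) hW0) (by norm_num))
      (div_nonneg (mul_nonneg hσ0 (sq_nonneg _)) (by norm_num))).trans ?_
    rw [hs2, show t ^ 2 / N * W / 2 - σ2 * t ^ 2 / 2 = t ^ 2 / 2 * (W / N - σ2) by ring, abs_mul,
      abs_of_nonneg (by positivity : (0 : ℝ) ≤ t ^ 2 / 2)]
    exact mul_le_mul_of_nonneg_left hWN (by positivity)
  -- assemble
  have hterm1 : 2 * s ^ 2 * (Vd - Wd) ≤ 2 * t ^ 2 * (Vd / N - Nm * Vdk / N) := by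
    rw [hs2, show 2 * (t ^ 2 / N) * (Vd - Wd) = 2 * t ^ 2 * (Vd / N - Wd / N) by ring]
    refine mul_le_mul_of_nonneg_left ?_ (by positivity)
    have := div_le_div_of_nonneg_right hWdlow hNpos.le
    rw [mul_div_assoc] at this ⊢
    linarith
  have hterm2 : (#((box d n).image β) : ℝ) * (|s| ^ 3 * K ^ 3 + s ^ 4 * K ^ 4) ≤ t ^ 2 * (|s| * K ^ 3 + s ^ 2 * K ^ 4) := by
    have e : t ^ 2 * (|s| * K ^ 3 + s ^ 2 * K ^ 4) = N * (|s| ^ 3 * K ^ 3 + s ^ 4 * K ^ 4) := by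
      have habs : |s| ^ 3 = s ^ 2 * |s| := by rw [pow_succ, sq_abs]
      rw [habs, show s ^ 4 = s ^ 2 * s ^ 2 by ring, hs2]
      field_simp
    rw [e]
    have hK0 : 0 ≤ K := mul_nonneg (mul_nonneg (by norm_num) hM) (Nat.cast_nonneg _)
    exact mul_le_mul_of_nonneg_right hU (add_nonneg (mul_nonneg (pow_nonneg (abs_nonneg _) 3) (pow_nonneg hK0 3))
      (mul_nonneg (by positivity) (pow_nonneg hK0 4)))
  calc _ ≤ ‖∫ ω, cexp (((s * (∑ z ∈ box d n, X z ω - ∫ ω', ∑ z ∈ box d n, X z ω' ∂μ) : ℝ) : ℂ) * I) ∂μ -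
          ((Real.exp (-(s ^ 2 * W / 2)) : ℝ) : ℂ)‖ +
        ‖((Real.exp (-(s ^ 2 * W / 2)) : ℝ) : ℂ) - ((Real.exp (-(σ2 * t ^ 2 / 2)) : ℝ) : ℂ)‖ :=
        norm_sub_le_norm_sub_add_norm_sub _ _ _
    _ ≤ (2 * s ^ 2 * (Vd - Wd) + #((box d n).image β) * (|s| ^ 3 * K ^ 3 + s ^ 4 * K ^ 4)) +
        t ^ 2 / 2 * (|Vk / Nk - σ2| + 2 * Γ * (1 - Nm * Nk / N)) := add_le_add hB hG
    _ ≤ _ := by linarith [hterm1, hterm2]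

/-- **NEWMAN'S CLT FOR DOMINATED FIELDS, characteristic-function form**: `d ≥ 1`, `μ` positively associated, `X`
measurable with `|X_z| ≤ M` and summable covariance kernel `γ`, dominated by a measurable bounded field `X̃` with
summable kernel `γ̃`. Then `E exp(it(S_n − E S_n)/√|Λ_n|) → exp(−σ²t²/2)`, `σ² = Σ_z γ(z)`.
[cite: Newman1980, Thm. 2 and the remark after (12)] -/
theorem tendsto_charFun_boxSum_of_dominated (hd : 1 ≤ d) (hμ : IsPositivelyAssociated μ)
    (hXm : ∀ z, Measurable (X z)) (hM : 0 ≤ M) (hXb : ∀ z ω, |X z ω| ≤ M)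
    (hcov : ∀ x y, cov[X x, X y; μ] = γ (y - x)) (hγ : Summable γ)
    (hXdm : ∀ z, Measurable (Xd z)) (hXdb : ∀ z ω, |Xd z ω| ≤ Md) (hcovd : ∀ x y, cov[Xd x, Xd y; μ] = γd (y - x))
    (hγd : Summable γd) (hdom : ∀ z, ∀ ⦃ω ω'⦄, ω ≤ ω' → |X z ω' - X z ω| ≤ Xd z ω' - Xd z ω) (t : ℝ) :
    Tendsto (fun n : ℕ => ∫ ω, cexp ((((t / Real.sqrt #(box d n)) *
        (∑ z ∈ box d n, X z ω - ∫ ω', ∑ z ∈ box d n, X z ω' ∂μ) : ℝ) : ℂ) * I) ∂μ)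
      atTop (𝓝 ((Real.exp (-((∑' z, γ z) * t ^ 2 / 2)) : ℝ) : ℂ)) := by
  have hXdmono : ∀ z, Monotone (Xd z) := monotone_of_dominated_field hdom
  have hγd0 : ∀ z, 0 ≤ γd z := covariance_kernel_nonneg hμ hXdm hXdmono hXdb hcovd
  set σ2 : ℝ := ∑' z, γ z with hσ2
  set σd : ℝ := ∑' z, γd z with hσd
  set Γ : ℝ := ∑' z, |γ z| with hΓ
  have hΓ0 : 0 ≤ Γ := tsum_nonneg fun z => abs_nonneg _
  have hσd0 : 0 ≤ σd := tsum_nonneg hγd0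
  set a : ℕ → ℝ := fun L => (∑ x ∈ box d L, ∑ y ∈ box d L, γ (y - x)) / #(box d L) with ha
  set ad : ℕ → ℝ := fun L => (∑ x ∈ box d L, ∑ y ∈ box d L, γd (y - x)) / #(box d L) with had
  have ha_lim : Tendsto a atTop (𝓝 σ2) := tendsto_sum_sum_box_div_card_of_summable γ hγ
  have had_lim : Tendsto ad atTop (𝓝 σd) := tendsto_sum_sum_box_div_card γd hγd0 hγd
  have had_le : ∀ L, ad L ≤ σd := sum_sum_box_div_card_le_tsum γd hγd0 hγd
  have hN : Tendsto (fun n : ℕ => (#(box d n) : ℝ)) atTop atTop := by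
    have h0 : ∀ n : ℕ, n ≤ #(box d n) := fun n => by
      rw [card_box]; exact (show n ≤ 2 * n + 1 by omega).trans (Nat.le_self_pow (by omega) _)
    exact tendsto_natCast_atTop_atTop.comp (tendsto_atTop_mono h0 tendsto_id)
  have hs : Tendsto (fun n : ℕ => t / Real.sqrt #(box d n)) atTop (𝓝 0) :=
    tendsto_const_nhds.div_atTop (Real.tendsto_sqrt_atTop.comp hN)
  rw [Metric.tendsto_nhds]
  intro ε hε
  set C : ℝ := 2 * t ^ 2 * (2 + σd) + t ^ 2 + t ^ 2 / 2 * (1 + 2 * Γ) with hC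
  have hCnn : 0 ≤ C := by simp only [hC]; nlinarith [hσd0, hΓ0, sq_nonneg t]
  have hC0 : 0 < C + 1 := by linarith
  set ε₁ : ℝ := ε / (C + 1) with hε₁
  have hε₁0 : 0 < ε₁ := div_pos hε hC0
  -- choose `k` good for both kernels
  obtain ⟨k1, hk1⟩ := (Metric.tendsto_atTop.1 ha_lim ε₁ hε₁0)
  obtain ⟨k2, hk2⟩ := (Metric.tendsto_atTop.1 had_lim ε₁ hε₁0)
  set k := max k1 k2 with hk
  have hak : |a k - σ2| < ε₁ := by simpa [Real.dist_eq] using hk1 k (le_max_left _ _)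
  have hadk : |ad k - σd| < ε₁ := by simpa [Real.dist_eq] using hk2 k (le_max_right _ _)
  set K : ℝ := 2 * M * #(box d k) with hK
  have hr := tendsto_card_box_mul_card_box_div d k
  have e1 := (Metric.tendsto_nhds.1 had_lim) ε₁ hε₁0
  have e2 := (Metric.tendsto_nhds.1 hr) ε₁ hε₁0
  have hsK : Tendsto (fun n : ℕ => |t / Real.sqrt #(box d n)| * K ^ 3 + (t / Real.sqrt #(box d n)) ^ 2 * K ^ 4)
      atTop (𝓝 0) := by
    have h1 := (continuous_abs.tendsto (0 : ℝ)).comp hs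
    have h2 := hs.pow 2
    simpa using (h1.mul_const (K ^ 3)).add (h2.mul_const (K ^ 4))
  have e3 := (Metric.tendsto_nhds.1 hsK) ε₁ hε₁0
  have hsK2 : Tendsto (fun n : ℕ => (t / Real.sqrt #(box d n)) ^ 2 * K ^ 2) atTop (𝓝 0) := by
    simpa using (hs.pow 2).mul_const (K ^ 2)
  have e4 := (tendsto_order.1 hsK2).2 2 (by norm_num)
  filter_upwards [eventually_ge_atTop k, e1, e2, e3, e4] with n hkn h1 h2 h3 h4
  rw [Real.dist_eq] at h1 h2 h3
  rw [dist_eq_norm]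
  have hmain := norm_charFun_boxSum_sub_le_of_dominated hμ hXm hM hXb hcov hγ hXdm hXdb hcovd hdom hkn t h4.le
  set r : ℝ := (#(box d ((n - k) / (2 * k + 1))) : ℝ) * #(box d k) / #(box d n) with hrdef
  have hkpos : (0 : ℝ) < #(box d k) := card_box_pos d k
  have hΔ : (∑ x ∈ box d n, ∑ y ∈ box d n, γd (y - x)) / #(box d n) -
      #(box d ((n - k) / (2 * k + 1))) * (∑ x ∈ box d k, ∑ y ∈ box d k, γd (y - x)) / #(box d n) =
        ad n - r * ad k := by
    simp only [had, hrdef]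
    field_simp
  have hak' : (∑ x ∈ box d k, ∑ y ∈ box d k, γ (y - x)) / #(box d k) = a k := rfl
  rw [hΔ, hak'] at hmain
  have hadk0 : 0 ≤ ad k := div_nonneg (sum_sum_kernel_nonneg hμ hXdm hXdmono hXdb hcovd _ _) (Nat.cast_nonneg _)
  have hΔle : ad n - r * ad k ≤ ε₁ * (2 + σd) := by
    have e : ad n - r * ad k = (ad n - σd) + (σd - ad k) + (1 - r) * ad k := by ring
    rw [e]
    have i1 : ad n - σd ≤ ε₁ := (le_abs_self _).trans h1.le
    have i2 : σd - ad k ≤ ε₁ := by linarith [(neg_abs_le (ad k - σd))]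
    have i3 : (1 - r) * ad k ≤ ε₁ * σd := by
      refine (le_abs_self _).trans ?_
      rw [abs_mul, abs_of_nonneg hadk0, abs_sub_comm]
      exact mul_le_mul h2.le (had_le k) hadk0 hε₁0.le
    linarith
  have h3' : |t / Real.sqrt #(box d n)| * K ^ 3 + (t / Real.sqrt #(box d n)) ^ 2 * K ^ 4 < ε₁ := by
    have := (le_abs_self _).trans_lt h3; simpa using this
  have h1r : 1 - r ≤ ε₁ := by
    have := (neg_abs_le (r - 1)); linarith [h2.le]
  calc _ ≤ 2 * t ^ 2 * (ad n - r * ad k) + t ^ 2 * (|t / Real.sqrt #(box d n)| * K ^ 3 +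
          (t / Real.sqrt #(box d n)) ^ 2 * K ^ 4) + t ^ 2 / 2 * (|a k - σ2| + 2 * Γ * (1 - r)) := hmain
    _ ≤ 2 * t ^ 2 * (ε₁ * (2 + σd)) + t ^ 2 * ε₁ + t ^ 2 / 2 * (ε₁ + 2 * Γ * ε₁) := by
        gcongr
    _ = ε₁ * C := by simp only [hC]; ring
    _ < ε := by
        rw [hε₁, div_mul_eq_mul_div, div_lt_iff₀ hC0]
        exact mul_lt_mul_of_pos_left (lt_add_one C) hε

/-- **NEWMAN'S CLT FOR DOMINATED FIELDS**, convergence in distribution: under the hypotheses of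
`tendsto_charFun_boxSum_of_dominated`, `(S_n − E S_n)/√|Λ_n| → N(0, σ²)` in distribution, `σ² = Σ_z γ(z)` (as an
`ℝ≥0` `v`), for any `Y ~ gaussianReal 0 v`. [cite: Newman1980, Thm. 2 and the remark after (12)] -/
theorem tendstoInDistribution_boxSum_of_dominated {Ω' : Type*} {mΩ' : MeasurableSpace Ω'} {P' : Measure Ω'}
    [IsProbabilityMeasure P'] {Y : Ω' → ℝ} (hd : 1 ≤ d) (hμ : IsPositivelyAssociated μ)
    (hXm : ∀ z, Measurable (X z)) (hM : 0 ≤ M) (hXb : ∀ z ω, |X z ω| ≤ M)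
    (hcov : ∀ x y, cov[X x, X y; μ] = γ (y - x)) (hγ : Summable γ)
    (hXdm : ∀ z, Measurable (Xd z)) (hXdb : ∀ z ω, |Xd z ω| ≤ Md) (hcovd : ∀ x y, cov[Xd x, Xd y; μ] = γd (y - x))
    (hγd : Summable γd) (hdom : ∀ z, ∀ ⦃ω ω'⦄, ω ≤ ω' → |X z ω' - X z ω| ≤ Xd z ω' - Xd z ω)
    {v : NNReal} (hv' : (v : ℝ) = ∑' z, γ z) (hY : HasLaw Y (gaussianReal 0 v) P') :
    TendstoInDistribution (fun (n : ℕ) ω => (Real.sqrt #(box d n))⁻¹ *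
        (∑ z ∈ box d n, X z ω - ∫ ω', ∑ z ∈ box d n, X z ω' ∂μ)) atTop Y (fun _ => μ) P' where
  forall_aemeasurable n := ((measurable_fieldSum hXm (box d n)).sub_const _ |>.const_mul _).aemeasurable
  aemeasurable_limit := hY.aemeasurable
  tendsto := by
    refine ProbabilityMeasure.tendsto_iff_tendsto_charFun.2 fun t => ?_
    rw! [hY.map_eq]
    have hlim := tendsto_charFun_boxSum_of_dominated hd hμ hXm hM hXb hcov hγ hXdm hXdb hcovd hγd hdom t
    have hgauss : charFun (gaussianReal 0 v) t = ((Real.exp (-((∑' z, γ z) * t ^ 2 / 2)) : ℝ) : ℂ) := by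
      rw [charFun_gaussianReal, Complex.ofReal_exp, hv']
      congr 1
      push_cast
      ring
    simp only [ProbabilityMeasure.coe_mk]
    rw [hgauss]
    refine hlim.congr fun n => ?_
    rw [charFun_apply_real, integral_map (((measurable_fieldSum hXm (box d n)).sub_const _
      |>.const_mul _).aemeasurable) (by fun_prop)]
    refine integral_congr_ae (ae_of_all _ fun ω => ?_)
    push_cast
    ring_nf

end NewmanCLT

end Summit.CriticalPhenomena.PercolationContinuityZ3.Theorems.FK
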